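import Summits.Ventures.LatticeQCDFlow.Exactness.FlowSamplerLogConvex
import Summits.Ventures.LatticeQCDFlow.Exactness.FlowSamplerAutocorrelation
import HarnessLib

/-!
# The `τ_int` FLOOR of the flow sampler: `(1 + ρ₁)/(2(1 − ρ₁)) ≤ τ_int`, monotone windows, and the sandwich `≤ W − ½`

HONEST FRAMING: exact (Metropolis-corrected) sampling algorithms for lattice gauge theory;
figures of merit are autocorrelation/cost numbers at stated couplings and volumes; no
continuum-physics claim.  (SCALAR calibration rung S0-A: not a gauge result.)

Venture `LatticeQCDFlow` (cell pub-lqcd), topic `Exactness`; FANOUT row 2 (`s0-phi4`, FLOW arm).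
NEW WORK of the cell, composing `Exactness/FlowSamplerPositive.lean` (positivity, rejection floor),
`Exactness/FlowSamplerLogConvex.lean` (log-convexity, the sequence lemmas) and gen-10's
`Exactness/FlowSamplerAutocorrelation.lean` (the CEILING `τ_int ≤ W − ½` under a weight bound).
Nothing is cited as a fact; printed counterparts named in `FlowSamplerLogConvex.lean`
(Madras–Slade 1993 Prop. 9.2.2; Liu 1996).

## What is proved

* §4b (general `(X, μ)`; `w > 0` integrable, `q > 0`, `∫ q = 1`; `g` bounded measurable;
  `ρ(n) = ∫ g (Kⁿ g) w / ∫ g² w`):  **`autocorr_pow_le`** `ρ(1)^(n+1) ≤ ρ(n+1)`;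
  **`rejection_le_autocorr_one`** `r_g ≤ ρ(1)`, `r_g = (∫ g² w r)/(∫ g² w)` the `g²`-weighted mean
  rejection probability; **`imhOp_tauIntWindow_mono`** (`W ↦ τ_W` nondecreasing — at the population
  level the Γ-method's truncation can only UNDER-state `τ_int` for this sampler); under summability
  of the autocorrelation series: `imhOp_tauIntWindow_le_tauInt` (`ρ(1) < 1`, `τ_W ≤ τ_int`),
  **`imhOp_tauInt_ge`** `τ_int ≥ (1 + ρ(1))/(2(1 − ρ(1)))`, **`imhOp_tauInt_ge_rejection`**
  `τ_int ≥ ½ + r_g/(1 − r_g)`; and **`imhOp_tauInt_sandwich`**: under a weight bound `w ≤ C q`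
  (mean-zero `g`) summability is automatic and `(1 + ρ(1))/(2(1 − ρ(1))) ≤ τ_int ≤ C/Z − ½`.
* §5 (the lattice `ℝ^Λ`, row 2's sampler `imhOpPhi4 J λ q̃`; every `λ > 0`, every real `J`, every
  positive measurable model density with `∫ q̃ = 1`; `f` bounded measurable, `g = f − ⟨f⟩`):
  `imhAcceptPhi4_eq_imhAcceptQ` (`rfl`), **`phi4Flow_autocov_nonneg`** (`0 ≤ ∫ g (Kᵏ g) e^{−S}`
  for every `k`, NO weight bound), **`phi4Flow_autocorr_pow_le`** (`ρ(1)^(k+1) ≤ ρ(k+1)`),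
  **`phi4Flow_tauIntWindow_mono`**, **`phi4Flow_tauInt_ge`** (summable series ⇒ both floors) and
  **`phi4Flow_tauInt_sandwich`** (weight bound `e^{−S} ≤ W·Z·q̃` ⇒ summable, `τ_{W'} ≤ τ_int`,
  `(1 + ρ(1))/(2(1 − ρ(1))) ≤ τ_int ≤ W − ½`).

Reading for S0-A (no numerics implied): for the flow arm, (i) every observable's autocorrelation
function is nonnegative and at least geometric in its lag-one value, so a measured `ρ̂(1)` alone
certifies a floor on `τ_int` and hence a CEILING on ESS per sample, `≤ (1 − ρ(1))/(1 + ρ(1))`;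
(ii) the floor is at least `½ + r_f/(1 − r_f)` in the observable's `g²`-weighted rejection rate —
rejections cost exactly as for a geometric chain; (iii) windowed `τ̂` estimates of this sampler are
biased LOW at the population level, never high.  Together with gen-10's ceiling this is the
two-sided statement `(1 + ρ(1))/(2(1 − ρ(1))) ≤ τ_int ≤ W − ½`.
NOT CLAIMED: HMC or local Metropolis (their operators are not positive in general); unbounded
observables; statistical properties of the Γ-method estimator; any number for a trained network.
-/

namespace Summit.Ventures.LatticeQCDFlow.Exactness

open Real MeasureTheory Filter Finset Set
open Summit.Ventures.LatticeQCDFlow.Scoring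

/-! ## §4b Sampler-level consequences on a general state space -/

section Consequences

variable {X : Type*} [MeasurableSpace X] {μ : Measure X} [SFinite μ] {w q : X → ℝ}

/-- **`ρ(n) ≥ ρ(1)ⁿ`**: with `ρ(n) = ∫ g (Kⁿ g) w / ∫ g² w` the normalised stationary
autocorrelation of a bounded measurable observable: `ρ(1)^(n+1) ≤ ρ(n+1)` for every `n`. -/
theorem autocorr_pow_le (hw0 : ∀ t, 0 < w t) (hwm : Measurable w) (hwi : Integrable w μ)
    (hq0 : ∀ t, 0 < q t) (hqm : Measurable q) (hqi : Integrable q μ) (hq1 : ∫ t, q t ∂μ = 1)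
    {g : X → ℝ} (hgm : Measurable g) {B : ℝ} (hgb : ∀ t, |g t| ≤ B) (n : ℕ) :
    ((∫ t, g t * imhOp μ w q g t * w t ∂μ) / ∫ t, g t ^ 2 * w t ∂μ) ^ (n + 1)
      ≤ (∫ t, g t * ((imhOp μ w q)^[n + 1] g) t * w t ∂μ) / ∫ t, g t ^ 2 * w t ∂μ := by
  have h := logConvex_ratio_pow_le
    (a := fun k => ∫ t, g t * ((imhOp μ w q)^[k] g) t * w t ∂μ)
    (autocov_nonneg hw0 hwm hwi hq0 hqm hqi hq1 hgm hgb)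
    (autocov_logConvex hw0 hwm hwi hq0 hqm hqi hq1 hgm hgb) n
  have e0 : ∫ t, g t * ((imhOp μ w q)^[0] g) t * w t ∂μ = ∫ t, g t ^ 2 * w t ∂μ := by
    simp only [Function.iterate_zero, id_eq, sq]
  simp only [Function.iterate_one] at h
  rw [e0] at h
  exact h

/-- **`ρ(1)` IS AT LEAST THE `g²`-WEIGHTED REJECTION RATE**:
`(∫ g² w r)/(∫ g² w) ≤ ρ(1)`, `r(t) = ∫ (1 − α(t,t')) q(t') dμ(t')`. -/
theorem rejection_le_autocorr_one (hw0 : ∀ t, 0 < w t) (hwm : Measurable w)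
    (hwi : Integrable w μ) (hq0 : ∀ t, 0 < q t) (hqm : Measurable q) (hqi : Integrable q μ)
    (hq1 : ∫ t, q t ∂μ = 1) {g : X → ℝ} (hgm : Measurable g) {B : ℝ} (hgb : ∀ t, |g t| ≤ B) :
    (∫ t, g t ^ 2 * w t * (∫ t', (1 - imhAcceptQ w q t t') * q t' ∂μ) ∂μ) / ∫ t, g t ^ 2 * w t ∂μ
      ≤ (∫ t, g t * imhOp μ w q g t * w t ∂μ) / ∫ t, g t ^ 2 * w t ∂μ :=
  div_le_div_of_nonneg_right (integral_sq_mul_rejection_le hw0 hwm hwi hq0 hqm hqi hq1 hgm hgb)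
    (integral_nonneg fun t => mul_nonneg (sq_nonneg _) (hw0 t).le)

/-- **MONOTONE WINDOWS**: every windowed `τ_W` of the exact sampler's autocorrelation is
nondecreasing in `W` — at the population level the Γ-method's truncation can only UNDER-state
`τ_int` for this sampler. -/
theorem imhOp_tauIntWindow_mono (hw0 : ∀ t, 0 < w t) (hwm : Measurable w) (hwi : Integrable w μ)
    (hq0 : ∀ t, 0 < q t) (hqm : Measurable q) (hqi : Integrable q μ) (hq1 : ∫ t, q t ∂μ = 1)
    {g : X → ℝ} (hgm : Measurable g) {B : ℝ} (hgb : ∀ t, |g t| ≤ B) :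
    Monotone (tauIntWindow fun n =>
      (∫ t, g t * ((imhOp μ w q)^[n] g) t * w t ∂μ) / ∫ t, g t ^ 2 * w t ∂μ) :=
  tauIntWindow_mono_of_nonneg fun n => div_nonneg
    (autocov_nonneg hw0 hwm hwi hq0 hqm hqi hq1 hgm hgb (n + 1))
    (integral_nonneg fun t => mul_nonneg (sq_nonneg _) (hw0 t).le)

set_option maxHeartbeats 400000 in
/-- Under summability of the autocorrelation series (e.g. under a weight bound,
`FlowSamplerAutocorrelation`): `ρ(1) < 1` and EVERY WINDOW IS BELOW `τ_int`. -/
theorem imhOp_tauIntWindow_le_tauInt (hw0 : ∀ t, 0 < w t) (hwm : Measurable w)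
    (hwi : Integrable w μ) (hq0 : ∀ t, 0 < q t) (hqm : Measurable q) (hqi : Integrable q μ)
    (hq1 : ∫ t, q t ∂μ = 1) {g : X → ℝ} (hgm : Measurable g) {B : ℝ} (hgb : ∀ t, |g t| ≤ B)
    (hs : Summable fun n => (∫ t, g t * ((imhOp μ w q)^[n + 1] g) t * w t ∂μ)
      / ∫ t, g t ^ 2 * w t ∂μ) (W : ℕ) :
    (∫ t, g t * imhOp μ w q g t * w t ∂μ) / (∫ t, g t ^ 2 * w t ∂μ) < 1
    ∧ tauIntWindow (fun n => (∫ t, g t * ((imhOp μ w q)^[n] g) t * w t ∂μ)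
          / ∫ t, g t ^ 2 * w t ∂μ) W
      ≤ tauInt (fun n => (∫ t, g t * ((imhOp μ w q)^[n] g) t * w t ∂μ)
          / ∫ t, g t ^ 2 * w t ∂μ) := by
  have hA0 : 0 ≤ ∫ t, g t ^ 2 * w t ∂μ :=
    integral_nonneg fun t => mul_nonneg (sq_nonneg _) (hw0 t).le
  have hnn : ∀ n, 0 ≤ (∫ t, g t * ((imhOp μ w q)^[n + 1] g) t * w t ∂μ) / ∫ t, g t ^ 2 * w t ∂μ :=
    fun n => div_nonneg (autocov_nonneg hw0 hwm hwi hq0 hqm hqi hq1 hgm hgb (n + 1)) hA0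
  have hpow := autocorr_pow_le hw0 hwm hwi hq0 hqm hqi hq1 hgm hgb
  have h1 : 0 ≤ (∫ t, g t * imhOp μ w q g t * w t ∂μ) / ∫ t, g t ^ 2 * w t ∂μ := by
    simpa using hnn 0
  obtain ⟨hlt, -⟩ := tauInt_ge_of_pow_le
    (ρ := fun n => (∫ t, g t * ((imhOp μ w q)^[n] g) t * w t ∂μ) / ∫ t, g t ^ 2 * w t ∂μ)
    (by simpa using h1) (by simpa using hpow) hs
  exact ⟨by simpa using hlt, tauIntWindow_le_tauInt_of_nonneg hnn hs W⟩

/-- **THE `τ_int` FLOOR.**  If the autocorrelation series of the bounded measurable observable `g`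
along the exact chain is summable, then `τ_int ≥ (1 + ρ(1))/(2(1 − ρ(1)))`,
`ρ(1) = ∫ g (K g) w / ∫ g² w`. -/
theorem imhOp_tauInt_ge (hw0 : ∀ t, 0 < w t) (hwm : Measurable w) (hwi : Integrable w μ)
    (hq0 : ∀ t, 0 < q t) (hqm : Measurable q) (hqi : Integrable q μ) (hq1 : ∫ t, q t ∂μ = 1)
    {g : X → ℝ} (hgm : Measurable g) {B : ℝ} (hgb : ∀ t, |g t| ≤ B)
    (hs : Summable fun n => (∫ t, g t * ((imhOp μ w q)^[n + 1] g) t * w t ∂μ)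
      / ∫ t, g t ^ 2 * w t ∂μ) :
    (1 + (∫ t, g t * imhOp μ w q g t * w t ∂μ) / ∫ t, g t ^ 2 * w t ∂μ)
        / (2 * (1 - (∫ t, g t * imhOp μ w q g t * w t ∂μ) / ∫ t, g t ^ 2 * w t ∂μ))
      ≤ tauInt (fun n => (∫ t, g t * ((imhOp μ w q)^[n] g) t * w t ∂μ)
          / ∫ t, g t ^ 2 * w t ∂μ) := by
  have hA0 : 0 ≤ ∫ t, g t ^ 2 * w t ∂μ :=
    integral_nonneg fun t => mul_nonneg (sq_nonneg _) (hw0 t).le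
  have hpow := autocorr_pow_le hw0 hwm hwi hq0 hqm hqi hq1 hgm hgb
  have h1 : 0 ≤ (∫ t, g t * imhOp μ w q g t * w t ∂μ) / ∫ t, g t ^ 2 * w t ∂μ :=
    div_nonneg (by simpa using autocov_nonneg hw0 hwm hwi hq0 hqm hqi hq1 hgm hgb 1) hA0
  obtain ⟨-, hge⟩ := tauInt_ge_of_pow_le
    (ρ := fun n => (∫ t, g t * ((imhOp μ w q)^[n] g) t * w t ∂μ) / ∫ t, g t ^ 2 * w t ∂μ)
    (by simpa using h1) (by simpa using hpow) hs
  simpa using hge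

/-- **THE REJECTION FLOOR**: under the same summability, `τ_int ≥ ½ + r_g/(1 − r_g)` with
`r_g = (∫ g² w r)/(∫ g² w)` the `g²`-weighted mean rejection probability of the sampler. -/
theorem imhOp_tauInt_ge_rejection (hw0 : ∀ t, 0 < w t) (hwm : Measurable w)
    (hwi : Integrable w μ) (hq0 : ∀ t, 0 < q t) (hqm : Measurable q) (hqi : Integrable q μ)
    (hq1 : ∫ t, q t ∂μ = 1) {g : X → ℝ} (hgm : Measurable g) {B : ℝ} (hgb : ∀ t, |g t| ≤ B)
    (hs : Summable fun n => (∫ t, g t * ((imhOp μ w q)^[n + 1] g) t * w t ∂μ)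
      / ∫ t, g t ^ 2 * w t ∂μ) :
    1 / 2 + ((∫ t, g t ^ 2 * w t * (∫ t', (1 - imhAcceptQ w q t t') * q t' ∂μ) ∂μ)
          / ∫ t, g t ^ 2 * w t ∂μ)
        / (1 - (∫ t, g t ^ 2 * w t * (∫ t', (1 - imhAcceptQ w q t t') * q t' ∂μ) ∂μ)
          / ∫ t, g t ^ 2 * w t ∂μ)
      ≤ tauInt (fun n => (∫ t, g t * ((imhOp μ w q)^[n] g) t * w t ∂μ)
          / ∫ t, g t ^ 2 * w t ∂μ) := by
  obtain ⟨hlt, -⟩ := imhOp_tauIntWindow_le_tauInt hw0 hwm hwi hq0 hqm hqi hq1 hgm hgb hs 0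
  have hge := imhOp_tauInt_ge hw0 hwm hwi hq0 hqm hqi hq1 hgm hgb hs
  have hrle := rejection_le_autocorr_one hw0 hwm hwi hq0 hqm hqi hq1 hgm hgb
  have hm := geomTauInt_mono hrle hlt
  have hr1 : (∫ t, g t ^ 2 * w t * (∫ t', (1 - imhAcceptQ w q t t') * q t' ∂μ) ∂μ)
      / ∫ t, g t ^ 2 * w t ∂μ < 1 := lt_of_le_of_lt hrle hlt
  set x := (∫ t, g t ^ 2 * w t * (∫ t', (1 - imhAcceptQ w q t t') * q t' ∂μ) ∂μ)
      / ∫ t, g t ^ 2 * w t ∂μ with hx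
  have e : (1 + x) / (2 * (1 - x)) = 1 / 2 + x / (1 - x) := by
    have h1x : 1 - x ≠ 0 := by linarith
    field_simp
    ring
  rw [e] at hm
  exact hm.trans hge

/-- **THE SANDWICH UNDER A WEIGHT BOUND** `w ≤ C q` (the uniformly ergodic regime of
`FlowSamplerAutocorrelation`): for a bounded measurable MEAN-ZERO `g` the autocorrelation series is
absolutely summable, every window is below `τ_int`, and
`(1 + ρ(1))/(2(1 − ρ(1))) ≤ τ_int ≤ C/Z − ½`. -/
theorem imhOp_tauInt_sandwich (hw0 : ∀ t, 0 < w t) (hwm : Measurable w) (hwi : Integrable w μ)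
    (hq0 : ∀ t, 0 < q t) (hqm : Measurable q) (hqi : Integrable q μ) (hq1 : ∫ t, q t ∂μ = 1)
    {C : ℝ} (hC : ∀ t, w t ≤ C * q t) {g : X → ℝ} (hgm : Measurable g) {B : ℝ}
    (hgb : ∀ t, |g t| ≤ B) (hg0 : ∫ t, g t * w t ∂μ = 0) :
    (Summable fun n => (∫ t, g t * ((imhOp μ w q)^[n + 1] g) t * w t ∂μ) / ∫ t, g t ^ 2 * w t ∂μ)
    ∧ (∀ W, tauIntWindow (fun n => (∫ t, g t * ((imhOp μ w q)^[n] g) t * w t ∂μ)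
          / ∫ t, g t ^ 2 * w t ∂μ) W
        ≤ tauInt (fun n => (∫ t, g t * ((imhOp μ w q)^[n] g) t * w t ∂μ)
          / ∫ t, g t ^ 2 * w t ∂μ))
    ∧ (1 + (∫ t, g t * imhOp μ w q g t * w t ∂μ) / ∫ t, g t ^ 2 * w t ∂μ)
        / (2 * (1 - (∫ t, g t * imhOp μ w q g t * w t ∂μ) / ∫ t, g t ^ 2 * w t ∂μ))
      ≤ tauInt (fun n => (∫ t, g t * ((imhOp μ w q)^[n] g) t * w t ∂μ)
          / ∫ t, g t ^ 2 * w t ∂μ)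
    ∧ tauInt (fun n => (∫ t, g t * ((imhOp μ w q)^[n] g) t * w t ∂μ) / ∫ t, g t ^ 2 * w t ∂μ)
      ≤ C / (∫ s, w s ∂μ) - 1 / 2 := by
  obtain ⟨_, _, hr0, hr1⟩ := rate_bounds hw0 hwi hq0 hqi hq1 hC
  have hrabs : |1 - (∫ s, w s ∂μ) / C| < 1 := by rw [abs_of_nonneg hr0]; exact hr1
  have hs : Summable fun n => (∫ t, g t * ((imhOp μ w q)^[n + 1] g) t * w t ∂μ)
      / ∫ t, g t ^ 2 * w t ∂μ :=
    Summable.of_norm_bounded (hasSum_geometric_succ hrabs).summable fun k => by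
      rw [Real.norm_eq_abs]
      exact abs_autocorr_le hw0 hwm hwi hq0 hqm hqi hq1 hC hgm hgb hg0 (k + 1)
  exact ⟨hs, fun W => (imhOp_tauIntWindow_le_tauInt hw0 hwm hwi hq0 hqm hqi hq1 hgm hgb hs W).2,
    imhOp_tauInt_ge hw0 hwm hwi hq0 hqm hqi hq1 hgm hgb hs,
    tauInt_autocorr_le hw0 hwm hwi hq0 hqm hqi hq1 hC hgm hgb hg0⟩

end Consequences

/-! ## §5 The lattice: row 2's φ⁴ flow sampler -/

section Lattice

variable {n : ℕ}

/-- Row 2's acceptance IS the general one: `imhAcceptPhi4 J λ q̃ = imhAcceptQ (e^{−S}) q̃`. -/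
theorem imhAcceptPhi4_eq_imhAcceptQ (J : Fin (n + 1) → Fin (n + 1) → ℝ) (lam : ℝ)
    (q : (Fin (n + 1) → ℝ) → ℝ) : imhAcceptPhi4 J lam q = imhAcceptQ (gibbsWeight J lam) q := by
  funext φ φ'
  rfl

/-- **NONNEGATIVE AUTOCOVARIANCES OF THE φ⁴ FLOW SAMPLER.**  `λ > 0`, any real `J`, ANY positive
measurable model density with `∫ q̃ = 1` (no weight bound needed); `f` bounded measurable,
`g = f − ⟨f⟩`.  Then `0 ≤ ∫ g (Kᵏ g) e^{−S} dφ` for every lag `k`. -/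
theorem phi4Flow_autocov_nonneg {lam : ℝ} (hlam : 0 < lam) (J : Fin (n + 1) → Fin (n + 1) → ℝ)
    {q : (Fin (n + 1) → ℝ) → ℝ} (hq0 : ∀ φ, 0 < q φ) (hqm : Measurable q) (hqi : Integrable q)
    (hq1 : ∫ φ, q φ = 1) {f : (Fin (n + 1) → ℝ) → ℝ} (hfm : Measurable f) {B : ℝ}
    (hfb : ∀ φ, |f φ| ≤ B) (k : ℕ) :
    0 ≤ ∫ φ, (f φ - gibbsExpect J lam f)
        * ((imhOpPhi4 J lam q)^[k] (fun ψ => f ψ - gibbsExpect J lam f)) φ * gibbsWeight J lam φ := by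
  obtain ⟨hgm, hgb, -⟩ := centred_observable hlam J hfm hfb
  rw [imhOpPhi4_eq_imhOp]
  exact autocov_nonneg (μ := volume) (fun φ => gibbsWeight_pos J lam φ)
    (continuous_gibbsWeight J lam).measurable (integrable_gibbsWeight hlam J) hq0 hqm hqi hq1
    hgm hgb k

/-- **`ρ(k) ≥ ρ(1)ᵏ` FOR THE φ⁴ FLOW SAMPLER**: with `ρ(k) = C(k)/C(0)` the normalised stationary
autocorrelation of any bounded measurable observable, `ρ(1)^(k+1) ≤ ρ(k+1)`. -/
theorem phi4Flow_autocorr_pow_le {lam : ℝ} (hlam : 0 < lam) (J : Fin (n + 1) → Fin (n + 1) → ℝ)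
    {q : (Fin (n + 1) → ℝ) → ℝ} (hq0 : ∀ φ, 0 < q φ) (hqm : Measurable q) (hqi : Integrable q)
    (hq1 : ∫ φ, q φ = 1) {f : (Fin (n + 1) → ℝ) → ℝ} (hfm : Measurable f) {B : ℝ}
    (hfb : ∀ φ, |f φ| ≤ B) (k : ℕ) :
    ((∫ φ, (f φ - gibbsExpect J lam f)
        * imhOpPhi4 J lam q (fun ψ => f ψ - gibbsExpect J lam f) φ * gibbsWeight J lam φ)
        / ∫ φ, (f φ - gibbsExpect J lam f) ^ 2 * gibbsWeight J lam φ) ^ (k + 1)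
      ≤ (∫ φ, (f φ - gibbsExpect J lam f)
        * ((imhOpPhi4 J lam q)^[k + 1] (fun ψ => f ψ - gibbsExpect J lam f)) φ * gibbsWeight J lam φ)
        / ∫ φ, (f φ - gibbsExpect J lam f) ^ 2 * gibbsWeight J lam φ := by
  obtain ⟨hgm, hgb, -⟩ := centred_observable hlam J hfm hfb
  rw [imhOpPhi4_eq_imhOp]
  exact autocorr_pow_le (μ := volume) (fun φ => gibbsWeight_pos J lam φ)
    (continuous_gibbsWeight J lam).measurable (integrable_gibbsWeight hlam J) hq0 hqm hqi hq1
    hgm hgb k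

/-- **MONOTONE WINDOWS FOR THE φ⁴ FLOW SAMPLER**: `W ↦ τ_W` is nondecreasing for every bounded
observable (the Γ-method truncation under-states `τ_int` at the population level). -/
theorem phi4Flow_tauIntWindow_mono {lam : ℝ} (hlam : 0 < lam) (J : Fin (n + 1) → Fin (n + 1) → ℝ)
    {q : (Fin (n + 1) → ℝ) → ℝ} (hq0 : ∀ φ, 0 < q φ) (hqm : Measurable q) (hqi : Integrable q)
    (hq1 : ∫ φ, q φ = 1) {f : (Fin (n + 1) → ℝ) → ℝ} (hfm : Measurable f) {B : ℝ}
    (hfb : ∀ φ, |f φ| ≤ B) :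
    Monotone (tauIntWindow fun k => (∫ φ, (f φ - gibbsExpect J lam f)
        * ((imhOpPhi4 J lam q)^[k] (fun ψ => f ψ - gibbsExpect J lam f)) φ * gibbsWeight J lam φ)
        / ∫ φ, (f φ - gibbsExpect J lam f) ^ 2 * gibbsWeight J lam φ) := by
  obtain ⟨hgm, hgb, -⟩ := centred_observable hlam J hfm hfb
  rw [imhOpPhi4_eq_imhOp]
  exact imhOp_tauIntWindow_mono (μ := volume) (fun φ => gibbsWeight_pos J lam φ)
    (continuous_gibbsWeight J lam).measurable (integrable_gibbsWeight hlam J) hq0 hqm hqi hq1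
    hgm hgb

/-- **THE `τ_int` FLOOR FOR THE φ⁴ FLOW SAMPLER.**  If the autocorrelation series of the bounded
observable `f` is summable, then `τ_int(f) ≥ (1 + ρ(1))/(2(1 − ρ(1)))` AND
`τ_int(f) ≥ ½ + r_f/(1 − r_f)`, `r_f = ⟨g² r⟩/⟨g²⟩` the `g²`-weighted mean rejection probability
(`g = f − ⟨f⟩`, `r(φ) = ∫ (1 − α(φ,φ')) q̃(φ') dφ'`). -/
theorem phi4Flow_tauInt_ge {lam : ℝ} (hlam : 0 < lam) (J : Fin (n + 1) → Fin (n + 1) → ℝ)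
    {q : (Fin (n + 1) → ℝ) → ℝ} (hq0 : ∀ φ, 0 < q φ) (hqm : Measurable q) (hqi : Integrable q)
    (hq1 : ∫ φ, q φ = 1) {f : (Fin (n + 1) → ℝ) → ℝ} (hfm : Measurable f) {B : ℝ}
    (hfb : ∀ φ, |f φ| ≤ B)
    (hs : Summable fun k => (∫ φ, (f φ - gibbsExpect J lam f)
        * ((imhOpPhi4 J lam q)^[k + 1] (fun ψ => f ψ - gibbsExpect J lam f)) φ * gibbsWeight J lam φ)
        / ∫ φ, (f φ - gibbsExpect J lam f) ^ 2 * gibbsWeight J lam φ) :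
    (1 + (∫ φ, (f φ - gibbsExpect J lam f)
          * imhOpPhi4 J lam q (fun ψ => f ψ - gibbsExpect J lam f) φ * gibbsWeight J lam φ)
          / ∫ φ, (f φ - gibbsExpect J lam f) ^ 2 * gibbsWeight J lam φ)
        / (2 * (1 - (∫ φ, (f φ - gibbsExpect J lam f)
          * imhOpPhi4 J lam q (fun ψ => f ψ - gibbsExpect J lam f) φ * gibbsWeight J lam φ)
          / ∫ φ, (f φ - gibbsExpect J lam f) ^ 2 * gibbsWeight J lam φ))
      ≤ tauInt (fun k => (∫ φ, (f φ - gibbsExpect J lam f)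
        * ((imhOpPhi4 J lam q)^[k] (fun ψ => f ψ - gibbsExpect J lam f)) φ * gibbsWeight J lam φ)
        / ∫ φ, (f φ - gibbsExpect J lam f) ^ 2 * gibbsWeight J lam φ)
    ∧ 1 / 2 + ((∫ φ, (f φ - gibbsExpect J lam f) ^ 2 * gibbsWeight J lam φ
            * (∫ φ', (1 - imhAcceptPhi4 J lam q φ φ') * q φ')) /
            ∫ φ, (f φ - gibbsExpect J lam f) ^ 2 * gibbsWeight J lam φ)
          / (1 - (∫ φ, (f φ - gibbsExpect J lam f) ^ 2 * gibbsWeight J lam φ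
            * (∫ φ', (1 - imhAcceptPhi4 J lam q φ φ') * q φ')) /
            ∫ φ, (f φ - gibbsExpect J lam f) ^ 2 * gibbsWeight J lam φ)
      ≤ tauInt (fun k => (∫ φ, (f φ - gibbsExpect J lam f)
        * ((imhOpPhi4 J lam q)^[k] (fun ψ => f ψ - gibbsExpect J lam f)) φ * gibbsWeight J lam φ)
        / ∫ φ, (f φ - gibbsExpect J lam f) ^ 2 * gibbsWeight J lam φ) := by
  obtain ⟨hgm, hgb, -⟩ := centred_observable hlam J hfm hfb
  rw [imhOpPhi4_eq_imhOp, imhAcceptPhi4_eq_imhAcceptQ] at *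
  exact ⟨imhOp_tauInt_ge (μ := volume) (fun φ => gibbsWeight_pos J lam φ)
      (continuous_gibbsWeight J lam).measurable (integrable_gibbsWeight hlam J) hq0 hqm hqi hq1
      hgm hgb hs,
    imhOp_tauInt_ge_rejection (μ := volume) (fun φ => gibbsWeight_pos J lam φ)
      (continuous_gibbsWeight J lam).measurable (integrable_gibbsWeight hlam J) hq0 hqm hqi hq1
      hgm hgb hs⟩

/-- **THE TWO-SIDED SANDWICH FOR THE φ⁴ FLOW SAMPLER UNDER THE WEIGHT BOUND**
`e^{−S} ≤ W·Z·q̃`: for every bounded measurable observable the autocorrelation series is summable,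
every window `τ_{W'} ≤ τ_int`, and `(1 + ρ(1))/(2(1 − ρ(1))) ≤ τ_int ≤ W − ½`. -/
theorem phi4Flow_tauInt_sandwich {lam : ℝ} (hlam : 0 < lam)
    (J : Fin (n + 1) → Fin (n + 1) → ℝ) {q : (Fin (n + 1) → ℝ) → ℝ} (hq0 : ∀ φ, 0 < q φ)
    (hqm : Measurable q) (hqi : Integrable q) (hq1 : ∫ φ, q φ = 1) {W : ℝ}
    (hW : ∀ φ, gibbsWeight J lam φ ≤ W * gibbsZ J lam * q φ) {f : (Fin (n + 1) → ℝ) → ℝ}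
    (hfm : Measurable f) {B : ℝ} (hfb : ∀ φ, |f φ| ≤ B) :
    (Summable fun k => (∫ φ, (f φ - gibbsExpect J lam f)
        * ((imhOpPhi4 J lam q)^[k + 1] (fun ψ => f ψ - gibbsExpect J lam f)) φ * gibbsWeight J lam φ)
        / ∫ φ, (f φ - gibbsExpect J lam f) ^ 2 * gibbsWeight J lam φ)
    ∧ (∀ W', tauIntWindow (fun k => (∫ φ, (f φ - gibbsExpect J lam f)
          * ((imhOpPhi4 J lam q)^[k] (fun ψ => f ψ - gibbsExpect J lam f)) φ * gibbsWeight J lam φ)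
          / ∫ φ, (f φ - gibbsExpect J lam f) ^ 2 * gibbsWeight J lam φ) W'
        ≤ tauInt (fun k => (∫ φ, (f φ - gibbsExpect J lam f)
          * ((imhOpPhi4 J lam q)^[k] (fun ψ => f ψ - gibbsExpect J lam f)) φ * gibbsWeight J lam φ)
          / ∫ φ, (f φ - gibbsExpect J lam f) ^ 2 * gibbsWeight J lam φ))
    ∧ (1 + (∫ φ, (f φ - gibbsExpect J lam f)
          * imhOpPhi4 J lam q (fun ψ => f ψ - gibbsExpect J lam f) φ * gibbsWeight J lam φ)
          / ∫ φ, (f φ - gibbsExpect J lam f) ^ 2 * gibbsWeight J lam φ)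
        / (2 * (1 - (∫ φ, (f φ - gibbsExpect J lam f)
          * imhOpPhi4 J lam q (fun ψ => f ψ - gibbsExpect J lam f) φ * gibbsWeight J lam φ)
          / ∫ φ, (f φ - gibbsExpect J lam f) ^ 2 * gibbsWeight J lam φ))
      ≤ tauInt (fun k => (∫ φ, (f φ - gibbsExpect J lam f)
        * ((imhOpPhi4 J lam q)^[k] (fun ψ => f ψ - gibbsExpect J lam f)) φ * gibbsWeight J lam φ)
        / ∫ φ, (f φ - gibbsExpect J lam f) ^ 2 * gibbsWeight J lam φ)
    ∧ tauInt (fun k => (∫ φ, (f φ - gibbsExpect J lam f)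
        * ((imhOpPhi4 J lam q)^[k] (fun ψ => f ψ - gibbsExpect J lam f)) φ * gibbsWeight J lam φ)
        / ∫ φ, (f φ - gibbsExpect J lam f) ^ 2 * gibbsWeight J lam φ) ≤ W - 1 / 2 := by
  have hZ := gibbsZ_pos hlam J
  obtain ⟨hgm, hgb, hg0⟩ := centred_observable hlam J hfm hfb
  have hC : ∀ φ, gibbsWeight J lam φ ≤ (W * gibbsZ J lam) * q φ := fun φ => hW φ
  have h := imhOp_tauInt_sandwich (μ := volume) (fun φ => gibbsWeight_pos J lam φ)
    (continuous_gibbsWeight J lam).measurable (integrable_gibbsWeight hlam J) hq0 hqm hqi hq1 hC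
    hgm hgb hg0
  have e : W * gibbsZ J lam / (∫ s, gibbsWeight J lam s) = W := by
    unfold gibbsZ
    have hZ' : (∫ s, gibbsWeight J lam s) ≠ 0 := by unfold gibbsZ at hZ; exact hZ.ne'
    field_simp
  rw [e] at h
  rw [imhOpPhi4_eq_imhOp]
  exact h

end Lattice

end Summit.Ventures.LatticeQCDFlow.Exactness
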